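import Literature.Probability.Percolation.FourArmGarbanDocking
import Literature.Probability.Percolation.FourArmGarbanReductionVar
import Literature.Probability.Percolation.ThinAnnulusCircuits
import HarnessLib

/-!
# Garban's multi-scale four-arm bound from the arms-to-sides bound (B.2) alone

Topic `Literature/Probability/Percolation`; support file for the named fact
`Garban2011_fourArm_multiscale` (`FourArmGarban.lean`; C. Garban, Appendix B of O. Schramm,
S. Smirnov, Ann. Probab. 39 (2011), Lemma B.1). Bond percolation on `ℤ²`, `p = 1/2`. Three
auxiliary definitions (`boxFinset`, the pairs of a block as a `Finset`; `dockO`, `dockD`, the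
circuit events read on a finite observation), no named fact; everything is proved.

## The point

Garban's (B.4), `E[X C_j] ≳ P[Q_j pivotal for X]`, is proved in the appendix with the circuit
annulus `S_j` INSIDE the pivotal square `Q_j`, which requires docking the four arms landing on
`∂Q_j` to the circuit ("by arm separation properties [...] if `δ` is chosen small enough").
Following J. van den Berg and P. Nolin (Progr. Probab. 77 (2020), §5: the pivotal region is put in
the HOLE of the structure carrying the bit) and the tree's `CrossingClusterBlockEstimate.lean`
(the same device for the cluster count), we take instead the pivotal block `H = j + B(h)` in the
hole of the annulus `S = j + A_{a,b}`, `h + 2 ≤ a`, both inside the mesoscopic square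
`T = j + B(S)`, `b + 2 ≤ S`. Then docking is automatic and (B.4) becomes an exact FKG
computation (`integral_crossingSign_mul_circuitBit_ge_boxPivotal`):

* on `O = {open circuit in S}` the crossing variable does not feel the opening of the hole,
  `X(ω) = X(ω ∪ H) =: X⁺(ω)`, and on `Δ = {closed dual circuit in S*}` it does not feel its
  closing, `X(ω) = X(ω ∖ H) =: X⁻(ω)` (`FourArmGarbanDocking.lean`);
* `X⁺`, `X⁻` are increasing functions of the configuration inside `T` given the outside, `O` is
  increasing and `Δ` decreasing, both read inside `T`; Harris' inequality for the conditional law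
  inside `T` ("the important fact that the event `{C_j = 1}` is increasing which enables to use FKG
  for the given conditional law inside `Q_j`", Garban; the tree's block form
  `integral_mul_indicator_le_measureReal_mul_integral`,
  `measureReal_mul_integral_le_integral_mul_indicator`) gives `E[X 1_O] = E[X⁺ 1_O] ≥ P(O) E[X⁺]`
  and `E[X 1_Δ] = E[X⁻ 1_Δ] ≤ P(Δ) E[X⁻]`;
* `P(O) = P(Δ)` at `p = 1/2` (`real_dualCircuitInAnnulusAt_half`) and `X⁺ - X⁻ = 2 · 1_{H pivotal}`,
  whence **`E[X C_j] ≥ 2 P(O) · P[H pivotal for X]`** with `C_j = 1_O - 1_Δ = circuitBit j a b` and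
  `[H pivotal for X] = boxPivotal (4n) j h`.

With `h = m`, `a = m + 2`, `b = 4m - 2`, `S = 4m`, the RSW bound `P(O) ≥ ρ₀`
(`exists_pos_le_real_openCircuitInAnnulusAt`) and the reduction
`Garban2011_fourArm_multiscale_of_separation_var` (revealment, orthogonality and the two-layer
Cauchy–Schwarz scheme, all in the tree), the named fact follows from Garban's (B.2), lower half,
ALONE (`Garban2011_fourArm_multiscale_of_boxPivotal`): for `t ≥ 1`, `n ≥ C₂ t` and centres
`j ∈ [n+2, 3n-2]²`, `c · π₄(t, n) ≤ P_{1/2}(boxPivotal (4n) j t)` — Kesten's arm-separation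
statement "four alternating arms can be required to land on the four sides" (Kesten 1987, §2;
Nolin 2008, Thm. 11 with Rem. 9), reduced further to its fenced form at the outer boundary in
`FourArmGarbanFencedToSides.lean`. No quasi-multiplicativity and no inward extension of arms is
needed.

## References

* O. Schramm, S. Smirnov (appendix by C. Garban), Ann. Probab. 39 (2011), Appendix B, proof of
  Lemma B.1, (B.2)–(B.5) [SchrammSmirnov2011].
* J. van den Berg, P. Nolin, Progr. Probab. 77 (2020) = arXiv:2008.01606, §5.2 ((G-B4a)–(G-B8):
  the pivotal site inside the structure carrying the bit) [VandenbergNolin2020].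
* H. Kesten, Comm. Math. Phys. 109 (1987), §2 [KestenScalingCMP1987]; P. Nolin, EJP 13 (2008),
  Thm. 11, Rem. 9 [Nolin2008] (the remaining input (B.2)).
-/

noncomputable section

namespace Literature.Probability.Percolation

open _root_.MeasureTheory Set LatticeModels
open scoped Classical

/-! ### Blocks as finite sets of pairs, and the circuit events read on an observation -/

section Obs

variable {j : Site 2} {a b S : ℕ}

/-- The pairs of the block `j + B(S)`, as a `Finset`. [folklore] -/
def boxFinset (j : Site 2) (S : ℕ) : Finset (Sym2 (Site 2)) := ((box 2 S).image (Site.shift j)).sym2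

/-- Its coercion is `boxPairs j S`. [folklore] -/
theorem coe_boxFinset (j : Site 2) (S : ℕ) : (↑(boxFinset j S) : Set (Sym2 (Site 2))) = boxPairs j S := by
  rw [boxFinset, boxPairs]

/-- The block predicate "open circuit of `j + A_{a,b}`", read on a finite set of pairs. [folklore] -/
def dockO (j : Site 2) (a b : ℕ) (ξ : Finset (Sym2 (Site 2))) : Prop :=
  (↑ξ : Set (Sym2 (Site 2))) ∈ openCircuitInAnnulusAt j a b

/-- The block predicate "closed dual circuit of `j + A_{a,b}`", read on a finite set of pairs.
[folklore] -/
def dockD (j : Site 2) (a b : ℕ) (ξ : Finset (Sym2 (Site 2))) : Prop :=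
  (↑ξ : Set (Sym2 (Site 2))) ∈ dualCircuitInAnnulusAt j a b

/-- `dockO` is increasing. [folklore] -/
theorem dockO_mono {ξ ξ' : Finset (Sym2 (Site 2))} (hξ : ξ ⊆ ξ') (h : dockO j a b ξ) : dockO j a b ξ' :=
  isUpperSet_openCircuitInAnnulusAt j a b (Finset.coe_subset.2 hξ) h

/-- `dockD` is decreasing. [folklore] -/
theorem dockD_anti {ξ ξ' : Finset (Sym2 (Site 2))} (hξ : ξ ⊆ ξ') (h : dockD j a b ξ') : dockD j a b ξ :=
  isLowerSet_dualCircuitInAnnulusAt j a b (Finset.coe_subset.2 hξ) h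

/-- A determined event reads the same on two configurations agreeing on a set containing its
determining set. [folklore] -/
theorem mem_iff_of_determinedBy {E : Set (BondConfig (Site 2))} {F B : Set (Sym2 (Site 2))}
    (hE : DeterminedBy E F) (hFB : F ⊆ B) {ω ω' : BondConfig (Site 2)} (h : ω ∩ B = ω' ∩ B) :
    ω ∈ E ↔ ω' ∈ E := by
  refine (determinedBy_iff E F).1 hE ω ω' ?_
  calc ω ∩ F = ω ∩ B ∩ F := by rw [inter_assoc, inter_eq_right.2 hFB]
    _ = ω' ∩ B ∩ F := by rw [h]
    _ = ω' ∩ F := by rw [inter_assoc, inter_eq_right.2 hFB]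

/-- The observation of `ζ` inside `B` agrees with `ζ` on `B`. [folklore] -/
theorem coe_obs_inter (ζ : BondConfig (Site 2)) (B : Finset (Sym2 (Site 2))) :
    (↑(obs ζ B) : Set (Sym2 (Site 2))) ∩ ↑B = ζ ∩ ↑B := by
  rw [coe_obs, inter_assoc, inter_self]

/-- Reading the open circuit on the observation inside the block (`b + 1 ≤ S`). [folklore] -/
theorem dockO_obs_iff (hbS : b + 1 ≤ S) (ζ : BondConfig (Site 2)) :
    dockO j a b (obs ζ (boxFinset j S)) ↔ ζ ∈ openCircuitInAnnulusAt j a b :=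
  mem_iff_of_determinedBy (determinedBy_openCircuitInAnnulusAt j a b)
    (fun _ he => (coe_boxFinset j S).symm ▸ circuitPairs_subset_boxPairs j hbS (Or.inl he))
    (coe_obs_inter ζ _)

/-- Reading the dual circuit on the observation inside the block (`b + 1 ≤ S`). [folklore] -/
theorem dockD_obs_iff (hbS : b + 1 ≤ S) (ζ : BondConfig (Site 2)) :
    dockD j a b (obs ζ (boxFinset j S)) ↔ ζ ∈ dualCircuitInAnnulusAt j a b :=
  mem_iff_of_determinedBy (determinedBy_dualCircuitInAnnulusAt j a b)
    (fun _ he => (coe_boxFinset j S).symm ▸ circuitPairs_subset_boxPairs j hbS (Or.inr he))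
    (coe_obs_inter ζ _)

/-- The open circuit event as the set of configurations whose observation satisfies `dockO`.
[folklore] -/
theorem setOf_dockO_obs (hbS : b + 1 ≤ S) :
    {ζ : BondConfig (Site 2) | dockO j a b (obs ζ (boxFinset j S))} = openCircuitInAnnulusAt j a b :=
  Set.ext fun ζ => dockO_obs_iff hbS ζ

/-- The dual circuit event as the set of configurations whose observation satisfies `dockD`.
[folklore] -/
theorem setOf_dockD_obs (hbS : b + 1 ≤ S) :
    {ζ : BondConfig (Site 2) | dockD j a b (obs ζ (boxFinset j S))} = dualCircuitInAnnulusAt j a b :=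
  Set.ext fun ζ => dockD_obs_iff hbS ζ

end Obs

/-! ### The crossing variable with the hole opened / closed -/

section Hole

variable {n : ℕ}

/-- `X = ±1`. [folklore] -/
theorem crossingSign_eq_one_or (hn : 1 ≤ n) (ω : BondConfig (Site 2)) :
    crossingSign n hn ω = 1 ∨ crossingSign n hn ω = -1 := by
  by_cases h : squareReach (4 * n) ω
  · exact Or.inl ((crossingSign_eq_one_iff n hn ω).2 h)
  · exact Or.inr ((crossingSign_eq_neg_one_iff n hn ω).2 h)

/-- **`X⁺ - X⁻ = 2 · 1_{H pivotal}`**: with `X⁺ = X(ω ∪ H)`, `X⁻ = X(ω ∖ H)` for the pairs `H` of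
the block `j + B(h)`, the difference is `2` on `boxPivotal (4n) j h` and `0` off it. [cite: SchrammSmirnov2011, Appendix B, proof of Lemma B.1 (definition of "Q_j pivotal for X")] -/
theorem crossingSign_union_sub_sdiff (hn : 1 ≤ n) (j : Site 2) (h : ℕ) (ω : BondConfig (Site 2)) :
    crossingSign n hn (ω ∪ boxPairs j h) - crossingSign n hn (ω \ boxPairs j h) =
      2 * (boxPivotal (4 * n) j h).indicator 1 ω := by
  by_cases hp : ω ∈ boxPivotal (4 * n) j h
  · rw [indicator_of_mem hp, Pi.one_apply, mul_one, (crossingSign_eq_one_iff n hn _).2 hp.1,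
      (crossingSign_eq_neg_one_iff n hn _).2 hp.2]
    norm_num
  · rw [indicator_of_notMem hp, mul_zero]
    -- not pivotal: `X⁺ = X⁻` (both `1` or both `-1`)
    have hle : crossingSign n hn (ω \ boxPairs j h) ≤ crossingSign n hn (ω ∪ boxPairs j h) :=
      monotone_crossingSign n hn (Set.sdiff_subset.trans subset_union_left)
    rcases crossingSign_eq_one_or hn (ω ∪ boxPairs j h) with h1 | h1 <;>
      rcases crossingSign_eq_one_or hn (ω \ boxPairs j h) with h2 | h2
    · rw [h1, h2]; norm_num
    · exact absurd ⟨(crossingSign_eq_one_iff n hn _).1 h1, (crossingSign_eq_neg_one_iff n hn _).1 h2⟩ hp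
    · rw [h1, h2] at hle; norm_num at hle
    · rw [h1, h2]; norm_num

/-- **On the open circuit the hole's opening is not felt: `X = X⁺` on `O`.** [cite: SchrammSmirnov2011, Appendix B, proof of Lemma B.1 (the display before (B.6), C_j = 1)] -/
theorem crossingSign_eq_union_of_mem_openCircuitInAnnulusAt (hn : 1 ≤ n) {j : Site 2} {h a b S : ℕ}
    (hc : BoxInside n j S) (hha : h + 1 ≤ a) (ha : 1 ≤ a) (hab : a ≤ b) (hbS : b + 1 ≤ S)
    {ω : BondConfig (Site 2)} (hO : ω ∈ openCircuitInAnnulusAt j a b) :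
    crossingSign n hn ω = crossingSign n hn (ω ∪ boxPairs j h) := by
  rcases crossingSign_eq_one_or hn (ω ∪ boxPairs j h) with h1 | h1
  · rw [h1, crossingSign_eq_one_iff]
    exact squareReach_of_squareReach_union_of_openCircuitInAnnulusAt hn hc hha ha hab hbS hO
      ((crossingSign_eq_one_iff n hn _).1 h1)
  · have hle : crossingSign n hn ω ≤ crossingSign n hn (ω ∪ boxPairs j h) :=
      monotone_crossingSign n hn subset_union_left
    rcases crossingSign_eq_one_or hn ω with h2 | h2
    · rw [h1, h2] at hle; norm_num at hle
    · rw [h1, h2]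

/-- **On the closed dual circuit the hole's closing is not felt: `X = X⁻` on `Δ`.** [cite: SchrammSmirnov2011, Appendix B, proof of Lemma B.1 ("the opposite bound for the term conditioned on C_j = -1")] -/
theorem crossingSign_eq_sdiff_of_mem_dualCircuitInAnnulusAt (hn : 1 ≤ n) {j : Site 2} {h a b S : ℕ}
    (hc : BoxInside n j S) (hha : h + 2 ≤ a) (hab : a ≤ b) (hbS : b + 2 ≤ S)
    {ω : BondConfig (Site 2)} (hD : ω ∈ dualCircuitInAnnulusAt j a b) :
    crossingSign n hn ω = crossingSign n hn (ω \ boxPairs j h) := by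
  rcases crossingSign_eq_one_or hn (ω \ boxPairs j h) with h1 | h1
  · have hle : crossingSign n hn (ω \ boxPairs j h) ≤ crossingSign n hn ω :=
      monotone_crossingSign n hn Set.sdiff_subset
    rcases crossingSign_eq_one_or hn ω with h2 | h2
    · rw [h1, h2]
    · rw [h1, h2] at hle; norm_num at hle
  · rw [h1, crossingSign_eq_neg_one_iff]
    exact not_squareReach_of_dualCircuitInAnnulusAt hn hc hha hab hbS hD
      ((crossingSign_eq_neg_one_iff n hn _).1 h1)

end Hole

/-! ### Garban's (B.4) with the pivotal block in the hole of the annulus -/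

section Covariance

variable {n : ℕ}

/-- **`E[X · C_j] ≥ 2 P(O) · P[H pivotal for X]`** (Garban's (B.4)–(B.5) with the pivotal block
`H = j + B(h)` in the hole of the circuit annulus `S = j + A_{a,b}`, `h + 2 ≤ a ≤ b`, inside the
square `j + B(S)`, `b + 2 ≤ S`, itself inside Garban's square: `BoxInside n j S`). Here
`X = crossingSign n hn`, `C_j = circuitBit j a b = 1_O - 1_Δ`, `P(O) = P(Δ)` at `p = 1/2`, and
`[H pivotal for X] = boxPivotal (4n) j h`. Proof: `E[X 1_O] = E[X⁺ 1_O] ≥ P(O) E[X⁺]` and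
`E[X 1_Δ] = E[X⁻ 1_Δ] ≤ P(Δ) E[X⁻]` by Harris' inequality for the conditional law inside the block,
and `X⁺ - X⁻ = 2 · 1_{H pivotal}`. [cite: SchrammSmirnov2011, Appendix B, proof of Lemma B.1, (B.4)-(B.5); VandenbergNolin2020 §5.2 (G-B4a)-(G-B8)] -/
theorem integral_crossingSign_mul_circuitBit_ge_boxPivotal (hn : 1 ≤ n) {j : Site 2} {h a b S : ℕ}
    (hc : BoxInside n j S) (hha : h + 2 ≤ a) (hab : a ≤ b) (hbS : b + 2 ≤ S) :
    2 * (bondPercolation (zdGraph 2) half).real (openCircuitInAnnulusAt j a b) *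
        (bondPercolation (zdGraph 2) half).real (boxPivotal (4 * n) j h) ≤
      ∫ ω, crossingSign n hn ω * circuitBit j a b ω ∂(bondPercolation (zdGraph 2) half) := by
  set P := bondPercolation (zdGraph 2) half with hP
  set T := boxFinset j S with hT
  set H : Set (Sym2 (Site 2)) := boxPairs j h with hH
  set Xp : BondConfig (Site 2) → ℝ := fun ω => crossingSign n hn (ω ∪ H) with hXp
  set Xm : BondConfig (Site 2) → ℝ := fun ω => crossingSign n hn (ω \ H) with hXm
  set O := openCircuitInAnnulusAt j a b with hOdef
  set D := dualCircuitInAnnulusAt j a b with hDdef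
  have hbS1 : b + 1 ≤ S := by omega
  have ha : 1 ≤ a := by omega
  -- measurability, bounds, integrability
  have hXm' : Measurable (crossingSign n hn) := measurable_crossingSign n hn
  have hXpm : Measurable Xp := hXm'.comp (measurable_union_const_pairs H)
  have hXmm : Measurable Xm := hXm'.comp (measurable_sdiff_const_pairs H)
  have hXpb : ∀ ω, |Xp ω| ≤ 1 := fun ω => abs_crossingSign_le n hn _
  have hXmb : ∀ ω, |Xm ω| ≤ 1 := fun ω => abs_crossingSign_le n hn _
  have hOm : MeasurableSet O := measurableSet_openCircuitInAnnulusAt j a b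
  have hDm : MeasurableSet D := measurableSet_dualCircuitInAnnulusAt j a b
  have hint : ∀ {g : BondConfig (Site 2) → ℝ}, Measurable g → (∀ ω, |g ω| ≤ 1) → Integrable g P :=
    fun hg hgb => Integrable.of_bound hg.aestronglyMeasurable 1
      (ae_of_all _ fun ω => by rw [Real.norm_eq_abs]; exact hgb ω)
  have hintA : ∀ {g : BondConfig (Site 2) → ℝ} {A : Set (BondConfig (Site 2))}, Measurable g →
      (∀ ω, |g ω| ≤ 1) → MeasurableSet A → Integrable (fun ω => g ω * A.indicator 1 ω) P := by
    intro g A hg hgb hAm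
    refine Integrable.of_bound (hg.mul (measurable_one.indicator hAm)).aestronglyMeasurable 1
      (ae_of_all _ fun ω => ?_)
    rw [Real.norm_eq_abs, abs_mul, indicator_apply]
    split_ifs <;> simp [hgb ω, (abs_nonneg (g ω)).trans (hgb ω)]
  -- (i) `X = X⁺` on `O`, `X = X⁻` on `Δ`
  have hXO : ∀ ω, crossingSign n hn ω * O.indicator 1 ω = Xp ω * O.indicator 1 ω := fun ω => by
    by_cases hω : ω ∈ O
    · rw [crossingSign_eq_union_of_mem_openCircuitInAnnulusAt hn hc (h := h) (by omega) ha hab hbS1 hω]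
    · simp [indicator_of_notMem hω]
  have hXD : ∀ ω, crossingSign n hn ω * D.indicator 1 ω = Xm ω * D.indicator 1 ω := fun ω => by
    by_cases hω : ω ∈ D
    · rw [crossingSign_eq_sdiff_of_mem_dualCircuitInAnnulusAt hn hc (h := h) hha hab hbS hω]
    · simp [indicator_of_notMem hω]
  -- (ii) Harris inside the block `T` given the outside, for `-X⁺` (antitone) with `O` (increasing)
  --      and for `-X⁻` (antitone) with `Δ` (decreasing)
  have hanti : ∀ (φ : BondConfig (Site 2) → BondConfig (Site 2)), Monotone φ →
      ∀ (ω : BondConfig (Site 2)) (ξ ξ' : Finset (Sym2 (Site 2))), ξ ⊆ ξ' → ξ' ⊆ T →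
        -crossingSign n hn (φ (ω \ ↑T ∪ ↑ξ')) ≤ -crossingSign n hn (φ (ω \ ↑T ∪ ↑ξ)) := by
    intro φ hφ ω ξ ξ' hξ _
    exact neg_le_neg (monotone_crossingSign n hn (hφ (union_subset_union_right _ (Finset.coe_subset.2 hξ))))
  have hOset : {ω : BondConfig (Site 2) | dockO j a b (obs ω T)} = O := setOf_dockO_obs hbS1
  have hDset : {ω : BondConfig (Site 2) | dockD j a b (obs ω T)} = D := setOf_dockD_obs hbS1
  have hHarrisO := integral_mul_indicator_le_measureReal_mul_integral (zdGraph 2) half T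
    (f := fun ω => -Xp ω) hXpm.neg (K := 1) (fun ω => by rw [abs_neg]; exact hXpb ω)
    (hanti (fun ω => ω ∪ H) fun _ _ hle => union_subset_union_left _ hle)
    (dockO j a b) (fun ξ ξ' hξ _ hO => dockO_mono hξ hO)
  have hHarrisD := measureReal_mul_integral_le_integral_mul_indicator (zdGraph 2) half T
    (f := fun ω => -Xm ω) hXmm.neg (K := 1) (fun ω => by rw [abs_neg]; exact hXmb ω)
    (hanti (fun ω => ω \ H) fun _ _ hle => Set.sdiff_subset_sdiff_left hle)
    (dockD j a b) (fun ξ ξ' hξ _ hD => dockD_anti hξ hD)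
  rw [hOset] at hHarrisO
  rw [hDset] at hHarrisD
  -- unfold the negations: `P(O) E[X⁺] ≤ E[X⁺ 1_O]`, `E[X⁻ 1_Δ] ≤ P(Δ) E[X⁻]`
  have hO' : P.real O * ∫ ω, Xp ω ∂P ≤ ∫ ω, Xp ω * O.indicator 1 ω ∂P := by
    have h1 : ∫ ω, -Xp ω * O.indicator 1 ω ∂P = -∫ ω, Xp ω * O.indicator 1 ω ∂P := by
      rw [← integral_neg]; exact integral_congr_ae (ae_of_all _ fun ω => by ring)
    rw [h1, integral_neg] at hHarrisO
    linarith
  have hD' : ∫ ω, Xm ω * D.indicator 1 ω ∂P ≤ P.real D * ∫ ω, Xm ω ∂P := by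
    have h1 : ∫ ω, -Xm ω * D.indicator 1 ω ∂P = -∫ ω, Xm ω * D.indicator 1 ω ∂P := by
      rw [← integral_neg]; exact integral_congr_ae (ae_of_all _ fun ω => by ring)
    rw [h1, integral_neg] at hHarrisD
    linarith
  -- (iii) `P(O) = P(Δ)` and `X⁺ - X⁻ = 2 · 1_{H pivotal}`
  have hOD : P.real D = P.real O := real_dualCircuitInAnnulusAt_half j a b
  have hdiff : ∫ ω, Xp ω ∂P - ∫ ω, Xm ω ∂P = 2 * P.real (boxPivotal (4 * n) j h) := by
    rw [← integral_sub (hint hXpm hXpb) (hint hXmm hXmb)]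
    have : ∀ ω, Xp ω - Xm ω = 2 * (boxPivotal (4 * n) j h).indicator 1 ω := fun ω =>
      crossingSign_union_sub_sdiff hn j h ω
    rw [integral_congr_ae (ae_of_all _ this), integral_const_mul, integral_indicator_one
      (measurableSet_boxPivotal hn j h)]
  -- (iv) assemble
  have hsplit : ∫ ω, crossingSign n hn ω * circuitBit j a b ω ∂P =
      ∫ ω, Xp ω * O.indicator 1 ω ∂P - ∫ ω, Xm ω * D.indicator 1 ω ∂P := by
    rw [← integral_sub (hintA hXpm hXpb hOm) (hintA hXmm hXmb hDm)]
    refine integral_congr_ae (ae_of_all _ fun ω => ?_)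
    simp only [circuitBit, mul_sub]
    rw [← hOdef, ← hDdef, hXO ω, hXD ω]
  rw [hsplit]
  calc 2 * P.real O * P.real (boxPivotal (4 * n) j h)
      = P.real O * (∫ ω, Xp ω ∂P - ∫ ω, Xm ω ∂P) := by rw [hdiff]; ring
    _ = P.real O * ∫ ω, Xp ω ∂P - P.real D * ∫ ω, Xm ω ∂P := by rw [hOD]; ring
    _ ≤ _ := by linarith

end Covariance

/-! ### The named fact from (B.2) alone -/

/-- **Garban's multi-scale four-arm bound from the arms-to-sides bound (B.2).** If (Garban's
(B.2), lower half; Kesten's arm separation with the four sides of the square as landing areas)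
there are `c > 0` and `C₂` with `c · P_{1/2}(fourArmTwoClusters t n) ≤ P_{1/2}(boxPivotal (4n) j t)`
for all `t ≥ 1`, `n ≥ C₂ t` and centres `j ∈ [n+2, 3n-2]²`, then the named fact
`Garban2011_fourArm_multiscale` holds. (Blocks `H = j + B(m)`, annuli `j + A_{m+2, 4m-2}` with
circuit probability `≥ ρ₀` (`exists_pos_le_real_openCircuitInAnnulusAt`, aspect `4`), squares
`j + B(4m)`; `integral_crossingSign_mul_circuitBit_ge_boxPivotal` and
`Garban2011_fourArm_multiscale_of_separation_var` with `K₂ = 1/(2ρ₀c)`.) [cite: SchrammSmirnov2011, Appendix B, Lemma B.1, (B.2) and (B.4)] -/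
theorem Garban2011_fourArm_multiscale_of_boxPivotal
    (hB2 : ∃ c : ℝ, 0 < c ∧ ∃ C₂ : ℕ, ∀ n t : ℕ, 1 ≤ t → C₂ * t ≤ n → ∀ j : Site 2,
      (∀ i : Fin 2, (n : ℤ) + 2 ≤ j i ∧ j i ≤ 3 * n - 2) →
        c * (bondPercolation (zdGraph 2) half).real (fourArmTwoClusters t n) ≤
          (bondPercolation (zdGraph 2) half).real (boxPivotal (4 * n) j t)) :
    Garban2011_fourArm_multiscale := by
  set P := bondPercolation (zdGraph 2) half with hP
  obtain ⟨cB, hcB, C₂, hb2⟩ := hB2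
  obtain ⟨ρ₀, hρ₀, hcirc⟩ := exists_pos_le_real_openCircuitInAnnulusAt (k := 4) (by norm_num)
  refine Garban2011_fourArm_multiscale_of_separation_var (fun m => 4 * m)
    (fun m _ _ => m + 2) (fun m _ _ => 4 * m - 2)
    (fun m _ => le_rfl) (fun m n j hm => by omega)
    (K₂ := 1 / (2 * ρ₀ * cB)) (by positivity) (C₀ := max 20 C₂) (le_max_left _ _)
    (m₀ := 4) (by norm_num) ?_
  intro m n hm hmn hn1 j hj
  have h20 : 20 * m ≤ n := le_trans (Nat.mul_le_mul_right _ (le_max_left _ _)) hmn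
  have hC₂n : C₂ * m ≤ n := le_trans (Nat.mul_le_mul_right _ (le_max_right _ _)) hmn
  have hn2 : 2 ≤ n := by omega
  have hjb := squareCentres_coord_bounds hn2 hj
  have hInside : BoxInside n j (4 * m) := fun i => by
    have := hjb i
    constructor <;> push_cast <;> omega
  -- (B.4) with the hole `j + B(m)` and the annulus `j + A_{m+2, 4m-2}` in the square `j + B(4m)`
  have hcov := integral_crossingSign_mul_circuitBit_ge_boxPivotal hn1 (j := j) (h := m) (a := m + 2)
    (b := 4 * m - 2) (S := 4 * m) hInside (by omega) (by omega) (by omega)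
  have hρ : ρ₀ ≤ P.real (openCircuitInAnnulusAt j (m + 2) (4 * m - 2)) :=
    hcirc j _ _ (by omega) (by omega) (by omega)
  -- (B.2)
  have hpiv : cB * P.real (fourArmTwoClusters m n) ≤ P.real (boxPivotal (4 * n) j m) :=
    hb2 n m (by omega) hC₂n j hjb
  have hmain : 2 * ρ₀ * cB * P.real (fourArmTwoClusters m n) ≤
      ∫ ω, crossingSign n hn1 ω * circuitBit j (m + 2) (4 * m - 2) ω ∂P := by
    refine le_trans ?_ hcov
    calc 2 * ρ₀ * cB * P.real (fourArmTwoClusters m n)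
        = 2 * ρ₀ * (cB * P.real (fourArmTwoClusters m n)) := by ring
      _ ≤ 2 * ρ₀ * P.real (boxPivotal (4 * n) j m) := by gcongr
      _ ≤ 2 * P.real (openCircuitInAnnulusAt j (m + 2) (4 * m - 2)) * P.real (boxPivotal (4 * n) j m) := by
          gcongr
  rw [one_div, ← div_eq_inv_mul, le_div_iff₀ (by positivity)]
  calc P.real (fourArmTwoClusters m n) * (2 * ρ₀ * cB) = 2 * ρ₀ * cB * P.real (fourArmTwoClusters m n) := by
        ring
    _ ≤ _ := hmain

end Literature.Probability.Percolation
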